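import Summits.QuantumFields.QCD.Theorems.HeatSlicedQuarksQuarkLoopCoefficientFreeMajorantToolkitAuxB

/-!
# Quark-loop coefficient, stub `freeMajorantToolkit`, part C: the mixed convolution

Conjunct (2) of the free majorant toolkit of the line `Sketch` of the crux `QuarkLoopCoefficient`:
for `0 < c`, `0 < ε < 1` there is `B` with
`Σ_y Γ_{(1−ε)c}(a, y) Γ_c(b, w − y) ≤ B Γ_{(1−ε)c}(a + b, w)` for all `a, b ≥ 0`, `w ∈ ℤ⁴`
(`Γ_c(t, w) = (1+t)⁻² exp(−c|w|²/(1+t+|w|))`, `gaussProfile`); the weaker constant `(1−ε)c` is the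
same on both sides, which is what the Grönwall bootstrap of the line needs.

Proof: with `p = 1+a`, `q = 1+b`, `x = |y|`, `z = |w−y|`, `R = |w| ≤ x + z`, `f_K(r) = r²/(K+r)`,
the summand is dominated POINTWISE by
`B₀ Γ_{(1−ε)c}(a+b, w) [Γ_{κ₁}(a, y) + Γ_{κ₂}(b, w−y)]` (`κ₁ = (1−ε)cε/4`, `κ₂ = εc/4`), by a
three-way case analysis: `q < p` — Engel `f_p(x) + f_q(z) ≥ f_{p+q}(R)` leaves `εc f_q(z)` spare
and `p⁻² ≤ 4(p+q−1)⁻²`; `p ≤ q`, `p + x ≤ 2(q + z)` — weighted Engel with weights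
`(1−ε)c(1−ε/4)` and `c` leaves `((1−ε)cε/4) f_p(x)` spare and `q⁻² ≤ 4(p+q−1)⁻²`; `p ≤ q`,
`p + x > 2(q+z)` — the Engel defect is `≥ q²/(24(q+z))`, which together with `εc f_q(z)` gives a
spare `κ q + (εc/4) f_q(z)`, and `e^{−κq} ≤ 2/(κq)²` supplies the missing `q⁻²`.  Summing the
pointwise bound uses the mass bound (5) of part B twice.
-/

namespace Summit.QuantumFields.QCD.Cruxes.QuarkLoopCoefficient.Sketch.FreeMajorantToolkit

open Summit.QuantumFields.QCD.Theorems.QuarkLoopCoefficient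
open Literature.MathematicalPhysics.QuantumLattice Literature.MathematicalPhysics.QuantumFieldTheory
open Literature.Probability.LatticeModels (Site TorusSite)
open scoped Matrix ComplexConjugate

/-! ### Exponent inequalities -/

/-- Engel plus monotonicity: `f_{p+q}(R) ≤ f_p(x) + f_q(z)` for `R ≤ x + z`. -/
theorem engel_mono {p q x z R : ℝ} (hp : 0 < p) (hq : 0 < q) (hx : 0 ≤ x) (hz : 0 ≤ z)
    (hR : 0 ≤ R) (hRxz : R ≤ x + z) :
    R ^ 2 / (p + q + R) ≤ x ^ 2 / (p + x) + z ^ 2 / (q + z) := by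
  have h1 : R ^ 2 / (p + q + R) ≤ (x + z) ^ 2 / (p + q + (x + z)) :=
    sq_div_add_mono (by linarith) hR hRxz
  have h2 := sq_div_add_sq_div_eq (x := x) (z := z) (p := p + x) (q := q + z) (by linarith)
    (by linarith)
  have h3 : 0 ≤ (x * (q + z) - z * (p + x)) ^ 2 / ((p + x) * (q + z) * (p + x + (q + z))) := by
    positivity
  have e : p + q + (x + z) = p + x + (q + z) := by ring
  rw [e] at h1
  linarith

/-- Weighted Engel in the balanced region `p + x ≤ 2(q + z)`:
`(1−ε)c (x+z)²/(p+q+x+z) ≤ (1−ε)c(1−ε/4) x²/(p+x) + c z²/(q+z)`. -/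
theorem weighted_engel_region {c ε p q x z : ℝ} (hc : 0 < c) (hε : 0 < ε) (hε1 : ε < 1)
    (hp : 0 < p) (hq : 0 < q) (hx : 0 ≤ x) (hz : 0 ≤ z) (hPQ : p + x ≤ 2 * (q + z)) :
    (1 - ε) * c * ((x + z) ^ 2 / (p + q + (x + z))) ≤
      (1 - ε) * c * (1 - ε / 4) * (x ^ 2 / (p + x)) + c * (z ^ 2 / (q + z)) := by
  have hε' : 0 < 1 - ε := by linarith
  have hε4 : 0 < 1 - ε / 4 := by linarith
  have hα : 0 < (1 - ε) * c * (1 - ε / 4) := by positivity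
  have hP : 0 < p + x := by linarith
  have hQ : 0 < q + z := by linarith
  have hw := sq_add_div_le_weighted (x := x) (z := z) hP hQ hα hc
  have hden : (p + x) / ((1 - ε) * c * (1 - ε / 4)) + (q + z) / c ≤
      (p + q + (x + z)) / ((1 - ε) * c) := by
    rw [div_add_div _ _ hα.ne' hc.ne', div_le_div_iff₀ (by positivity) (by positivity)]
    have e : (p + q + (x + z)) * ((1 - ε) * c * (1 - ε / 4) * c) -
        ((p + x) * c + (1 - ε) * c * (1 - ε / 4) * (q + z)) * ((1 - ε) * c) =
        c * ((1 - ε) * c) * ε * ((q + z) * (1 - ε / 4) - (p + x) / 4) := by ring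
    have hb : 0 ≤ (q + z) * (1 - ε / 4) - (p + x) / 4 := by nlinarith
    nlinarith [mul_nonneg (mul_nonneg (mul_nonneg hc.le (mul_nonneg hε'.le hc.le)) hε.le) hb]
  have hTpos : 0 < (p + x) / ((1 - ε) * c * (1 - ε / 4)) + (q + z) / c := by positivity
  have key : (1 - ε) * c * ((x + z) ^ 2 / (p + q + (x + z))) ≤
      (x + z) ^ 2 / ((p + x) / ((1 - ε) * c * (1 - ε / 4)) + (q + z) / c) := by
    have e : (1 - ε) * c * ((x + z) ^ 2 / (p + q + (x + z))) =
        (x + z) ^ 2 / ((p + q + (x + z)) / ((1 - ε) * c)) := by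
      field_simp
    rw [e]
    exact div_le_div_of_nonneg_left (sq_nonneg _) hTpos hden
  calc _ ≤ _ := key
    _ ≤ _ := hw
    _ = _ := by ring

/-- The Engel defect in the unbalanced region `2(q + z) < p + x` (with `1 ≤ p ≤ q`):
`(x+z)²/(p+q+x+z) + q²/(24(q+z)) ≤ x²/(p+x) + z²/(q+z)`. -/
theorem engel_defect_region {p q x z : ℝ} (hp : 1 ≤ p) (hpq : p ≤ q) (hx : 0 ≤ x) (hz : 0 ≤ z)
    (hPQ : 2 * (q + z) < p + x) :
    (x + z) ^ 2 / (p + q + (x + z)) + q ^ 2 / (24 * (q + z)) ≤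
      x ^ 2 / (p + x) + z ^ 2 / (q + z) := by
  have hP : 0 < p + x := by linarith
  have hQ : 0 < q + z := by linarith
  rw [sq_div_add_sq_div_eq hP hQ]
  have e : p + q + (x + z) = p + x + (q + z) := by ring
  rw [e]
  refine add_le_add le_rfl ?_
  rw [div_le_div_iff₀ (by positivity) (by positivity)]
  have hxz : 2 * z ≤ x := by linarith
  have hxp : p ≤ x := by linarith
  have hq0 : 0 ≤ q := by linarith
  have hkey : q * x / 2 ≤ x * (q + z) - z * (p + x) := by
    nlinarith [mul_nonneg hq0 (by linarith : (0 : ℝ) ≤ x - 2 * z),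
      mul_nonneg hz (by linarith : (0 : ℝ) ≤ q - p)]
  have hkey0 : 0 ≤ q * x / 2 := by positivity
  have hP2 : p + x ≤ 2 * x := by linarith
  have hPQ3 : p + x + (q + z) ≤ 3 * x := by linarith
  calc q ^ 2 * ((p + x) * (q + z) * (p + x + (q + z)))
      ≤ q ^ 2 * ((2 * x) * (q + z) * (3 * x)) := by gcongr
    _ = (q * x / 2) ^ 2 * (24 * (q + z)) := by ring
    _ ≤ (x * (q + z) - z * (p + x)) ^ 2 * (24 * (q + z)) := by gcongr

/-- `e^{−κq} ≤ (2/κ²) q⁻²` for `κ, q > 0`. -/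
theorem exp_neg_mul_le_inv_sq {κ q : ℝ} (hκ : 0 < κ) (hq : 0 < q) :
    Real.exp (-(κ * q)) ≤ 2 / κ ^ 2 * (q ^ 2)⁻¹ := by
  have h := Real.quadratic_le_exp_of_nonneg (by positivity : 0 ≤ κ * q)
  have h2 : (κ * q) ^ 2 / 2 ≤ Real.exp (κ * q) := by nlinarith [mul_pos hκ hq]
  rw [Real.exp_neg]
  calc (Real.exp (κ * q))⁻¹ ≤ ((κ * q) ^ 2 / 2)⁻¹ := by
        gcongr
    _ = 2 / κ ^ 2 * (q ^ 2)⁻¹ := by field_simp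

/-- `u⁻² ≤ 4 K⁻²` for `0 < K ≤ 2u`. -/
theorem inv_sq_le_four_inv_sq {u K : ℝ} (hu : 0 < u) (hK : 0 < K) (h : K ≤ 2 * u) :
    (u ^ 2)⁻¹ ≤ 4 * (K ^ 2)⁻¹ := by
  rw [inv_eq_one_div, inv_eq_one_div, mul_one_div, div_le_div_iff₀ (by positivity) (by positivity)]
  nlinarith [mul_le_mul h h hK.le (by linarith)]

/-! ### The pointwise domination -/

/-- The pointwise three-case bound, in real variables: for `1 ≤ p, q`, `x, z, R ≥ 0`, `R ≤ x + z`,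
`p⁻² e^{−(1−ε)c f_p(x)} · q⁻² e^{−c f_q(z)} ≤ B₀ · (p+q−1)⁻² e^{−(1−ε)c f_{p+q−1}(R)} ·
 [p⁻² e^{−((1−ε)cε/4) f_p(x)} + q⁻² e^{−(εc/4) f_q(z)}]`, `B₀ = 4e^{(1−ε)c}(1 + 2/κ²)`,
`κ = ε(1−ε)c/48`. -/
theorem conv_real {c ε p q x z R : ℝ} (hc : 0 < c) (hε : 0 < ε) (hε1 : ε < 1) (hp : 1 ≤ p)
    (hq : 1 ≤ q) (hx : 0 ≤ x) (hz : 0 ≤ z) (hR : 0 ≤ R) (hRxz : R ≤ x + z) :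
    (p ^ 2)⁻¹ * Real.exp (-((1 - ε) * c * (x ^ 2 / (p + x)))) *
        ((q ^ 2)⁻¹ * Real.exp (-(c * (z ^ 2 / (q + z))))) ≤
      (4 * Real.exp ((1 - ε) * c) * (1 + 2 / (ε * ((1 - ε) * c) / 48) ^ 2)) *
        (((p + q - 1) ^ 2)⁻¹ * Real.exp (-((1 - ε) * c * (R ^ 2 / (p + q - 1 + R))))) *
        ((p ^ 2)⁻¹ * Real.exp (-((1 - ε) * c * ε / 4 * (x ^ 2 / (p + x)))) +
          (q ^ 2)⁻¹ * Real.exp (-(ε * c / 4 * (z ^ 2 / (q + z))))) := by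
  have hε' : 0 < 1 - ε := by linarith
  have hc₁ : 0 < (1 - ε) * c := mul_pos hε' hc
  have hκ : 0 < ε * ((1 - ε) * c) / 48 := by positivity
  have hK0 : 0 < p + q - 1 := by linarith
  have hq0 : 0 < q := by linarith
  -- exponent facts, in raw form
  have hE0 : R ^ 2 / (p + q + R) ≤ x ^ 2 / (p + x) + z ^ 2 / (q + z) :=
    engel_mono (by linarith) (by linarith) hx hz hR hRxz
  have hmonoS : R ^ 2 / (p + q + R) ≤ (x + z) ^ 2 / (p + q + (x + z)) :=
    sq_div_add_mono (by linarith) hR hRxz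
  have hR1 : R ^ 2 / (p + q - 1 + R) ≤ R ^ 2 / (p + q + R) + 1 :=
    sq_div_add_le_add_one (K := p + q - 1) (K' := p + q) hK0 (by linarith) (by linarith) hR
  have hE2 : p + x ≤ 2 * (q + z) → (1 - ε) * c * ((x + z) ^ 2 / (p + q + (x + z))) ≤
      (1 - ε) * c * (1 - ε / 4) * (x ^ 2 / (p + x)) + c * (z ^ 2 / (q + z)) :=
    fun h => weighted_engel_region hc hε hε1 (by linarith) (by linarith) hx hz h
  have hE3 : p ≤ q → 2 * (q + z) < p + x → (x + z) ^ 2 / (p + q + (x + z)) +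
      q ^ 2 / (24 * (q + z)) ≤ x ^ 2 / (p + x) + z ^ 2 / (q + z) :=
    fun h1 h2 => engel_defect_region hp h1 hx hz h2
  have hqexp : Real.exp (-(ε * ((1 - ε) * c) / 48 * q)) ≤
      2 / (ε * ((1 - ε) * c) / 48) ^ 2 * (q ^ 2)⁻¹ := exp_neg_mul_le_inv_sq hκ hq0
  have hfp0 : 0 ≤ x ^ 2 / (p + x) := by positivity
  have hfq0 : 0 ≤ z ^ 2 / (q + z) := by positivity
  have hD0 : 0 ≤ q ^ 2 / (24 * (q + z)) := by positivity
  have hD1 : z ≤ q → q / 48 ≤ q ^ 2 / (24 * (q + z)) := fun hzq => by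
    rw [div_le_div_iff₀ (by norm_num) (by positivity)]
    have h := mul_le_mul_of_nonneg_left hzq hq0.le
    linarith
  have hfq1 : q < z → q / 2 ≤ z ^ 2 / (q + z) := fun hzq => by
    rw [le_div_iff₀ (by positivity)]
    have h := mul_nonneg (show (0 : ℝ) ≤ z - q by linarith) (show (0 : ℝ) ≤ 2 * z + q by linarith)
    linarith
  have h3 : c * (z ^ 2 / (q + z)) =
      (1 - ε) * c * (z ^ 2 / (q + z)) + ε * c * (z ^ 2 / (q + z)) := by ring
  have hκ1 : ε * ((1 - ε) * c) / 48 * q ≤ (1 - ε) * c * (q / 48) := by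
    have h := mul_nonneg (mul_nonneg hε'.le hc₁.le) hq0.le
    linarith
  have hκ2 : ε * ((1 - ε) * c) / 48 * q ≤ 3 * (ε * c) / 8 * q := by
    have h := mul_nonneg (mul_nonneg hε.le hc.le) hq0.le
    have h' := mul_nonneg (mul_nonneg (mul_nonneg hε.le hε.le) hc.le) hq0.le
    linarith
  -- opaque abbreviations
  generalize hc₁def : (1 - ε) * c = c₁ at hc₁ hκ hE2 hqexp h3 hκ1 hκ2 ⊢
  generalize hκdef : ε * c₁ / 48 = κ at hκ hqexp hκ1 hκ2 ⊢
  generalize hfp : x ^ 2 / (p + x) = fp at hE0 hE2 hE3 hfp0 ⊢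
  generalize hfq : z ^ 2 / (q + z) = fq at hE0 hE2 hE3 hfq0 h3 hfq1 ⊢
  generalize hfR : R ^ 2 / (p + q + R) = fR at hE0 hmonoS hR1
  generalize hfR' : R ^ 2 / (p + q - 1 + R) = fR' at hR1 ⊢
  generalize hfS : (x + z) ^ 2 / (p + q + (x + z)) = fS at hmonoS hE2 hE3
  generalize hD : q ^ 2 / (24 * (q + z)) = D at hE3 hD0 hD1
  generalize hKdef : p + q - 1 = K at hK0 ⊢
  set T := (K ^ 2)⁻¹ * Real.exp (-(c₁ * fR')) with hT
  set G₁ := (p ^ 2)⁻¹ * Real.exp (-(c₁ * ε / 4 * fp)) with hG₁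
  set G₂ := (q ^ 2)⁻¹ * Real.exp (-(ε * c / 4 * fq)) with hG₂
  have hT0 : 0 ≤ T := by positivity
  have hG₁0 : 0 ≤ G₁ := by positivity
  have hG₂0 : 0 ≤ G₂ := by positivity
  have hB : 4 * Real.exp c₁ ≤ 4 * Real.exp c₁ * (1 + 2 / κ ^ 2) :=
    le_mul_of_one_le_right (by positivity)
      (by have : 0 ≤ 2 / κ ^ 2 := by positivity
          linarith)
  have hB' : 4 * Real.exp c₁ * (2 / κ ^ 2) ≤ 4 * Real.exp c₁ * (1 + 2 / κ ^ 2) := by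
    gcongr; linarith
  have hfR1 : c₁ * fR' ≤ c₁ * (fp + fq) + c₁ := by
    have h := mul_le_mul_of_nonneg_left (show fR' ≤ fp + fq + 1 by linarith) hc₁.le
    linarith
  have hfR2 : c₁ * fR' ≤ c₁ * fS + c₁ := by
    have h := mul_le_mul_of_nonneg_left (show fR' ≤ fS + 1 by linarith) hc₁.le
    linarith
  have hεcfq : 0 ≤ ε * c * fq := mul_nonneg (mul_nonneg hε.le hc.le) hfq0
  have eLHS : (p ^ 2)⁻¹ * Real.exp (-(c₁ * fp)) * ((q ^ 2)⁻¹ * Real.exp (-(c * fq))) =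
      (p ^ 2)⁻¹ * (q ^ 2)⁻¹ * Real.exp (-(c₁ * fp) + -(c * fq)) := by
    rw [Real.exp_add]; ring
  rw [eLHS]
  rcases lt_or_ge q p with hqp | hpq
  · -- Case A: `q < p`; the second factor localises.
    have hpre : (p ^ 2)⁻¹ ≤ 4 * (K ^ 2)⁻¹ :=
      inv_sq_le_four_inv_sq (by linarith) hK0 (by linarith)
    have hexp : -(c₁ * fp) + -(c * fq) ≤ c₁ + -(c₁ * fR') + -(ε * c / 4 * fq) := by
      linarith
    calc (p ^ 2)⁻¹ * (q ^ 2)⁻¹ * Real.exp (-(c₁ * fp) + -(c * fq))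
        ≤ (4 * (K ^ 2)⁻¹) * (q ^ 2)⁻¹ * Real.exp (c₁ + -(c₁ * fR') + -(ε * c / 4 * fq)) := by
          gcongr
      _ = 4 * Real.exp c₁ * T * G₂ := by rw [Real.exp_add, Real.exp_add, hT, hG₂]; ring
      _ ≤ 4 * Real.exp c₁ * (1 + 2 / κ ^ 2) * T * G₂ :=
          mul_le_mul_of_nonneg_right (mul_le_mul_of_nonneg_right hB hT0) hG₂0
      _ ≤ 4 * Real.exp c₁ * (1 + 2 / κ ^ 2) * T * (G₁ + G₂) := by gcongr; linarith
  · have hpre : (q ^ 2)⁻¹ ≤ 4 * (K ^ 2)⁻¹ :=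
      inv_sq_le_four_inv_sq hq0 hK0 (by linarith)
    rcases le_or_gt (p + x) (2 * (q + z)) with hPQ | hPQ
    · -- Case B: balanced region; the first factor localises (weighted Engel).
      have hE2' := hE2 hPQ
      have hexp : -(c₁ * fp) + -(c * fq) ≤ c₁ + -(c₁ * fR') + -(c₁ * ε / 4 * fp) := by
        linarith
      calc (p ^ 2)⁻¹ * (q ^ 2)⁻¹ * Real.exp (-(c₁ * fp) + -(c * fq))
          ≤ (p ^ 2)⁻¹ * (4 * (K ^ 2)⁻¹) * Real.exp (c₁ + -(c₁ * fR') + -(c₁ * ε / 4 * fp)) := by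
            gcongr
        _ = 4 * Real.exp c₁ * T * G₁ := by rw [Real.exp_add, Real.exp_add, hT, hG₁]; ring
        _ ≤ 4 * Real.exp c₁ * (1 + 2 / κ ^ 2) * T * G₁ :=
            mul_le_mul_of_nonneg_right (mul_le_mul_of_nonneg_right hB hT0) hG₁0
        _ ≤ 4 * Real.exp c₁ * (1 + 2 / κ ^ 2) * T * (G₁ + G₂) := by gcongr; linarith
    · -- Case C: unbalanced region; the Engel defect and the spare `εc f_q` give `κ q`.
      have hE3' := mul_le_mul_of_nonneg_left (hE3 hpq hPQ) hc₁.le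
      have hspare : c₁ * fS + κ * q + ε * c / 4 * fq ≤ c₁ * fp + c * fq := by
        rcases le_or_gt z q with hzq | hzq
        · have h1' := mul_le_mul_of_nonneg_left (hD1 hzq) hc₁.le
          linarith
        · have h1' := mul_le_mul_of_nonneg_left (hfq1 hzq) (mul_nonneg hε.le hc.le)
          have h0 : 0 ≤ c₁ * D := mul_nonneg hc₁.le hD0
          linarith
      have hexp : -(c₁ * fp) + -(c * fq) ≤
          c₁ + -(c₁ * fR') + -(κ * q) + -(ε * c / 4 * fq) := by
        linarith [hspare, hfR2]
      have hp1 : (p ^ 2)⁻¹ ≤ 1 := inv_le_one_of_one_le₀ (one_le_pow₀ hp)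
      calc (p ^ 2)⁻¹ * (q ^ 2)⁻¹ * Real.exp (-(c₁ * fp) + -(c * fq))
          ≤ 1 * (4 * (K ^ 2)⁻¹) * Real.exp (c₁ + -(c₁ * fR') + -(κ * q) + -(ε * c / 4 * fq)) := by
            gcongr
        _ = 4 * Real.exp c₁ * T * Real.exp (-(κ * q)) * Real.exp (-(ε * c / 4 * fq)) := by
            rw [Real.exp_add, Real.exp_add, Real.exp_add, hT]; ring
        _ ≤ 4 * Real.exp c₁ * T * (2 / κ ^ 2 * (q ^ 2)⁻¹) * Real.exp (-(ε * c / 4 * fq)) := by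
            gcongr
        _ = 4 * Real.exp c₁ * (2 / κ ^ 2) * T * G₂ := by rw [hG₂]; ring
        _ ≤ 4 * Real.exp c₁ * (1 + 2 / κ ^ 2) * T * G₂ :=
            mul_le_mul_of_nonneg_right (mul_le_mul_of_nonneg_right hB' hT0) hG₂0
        _ ≤ 4 * Real.exp c₁ * (1 + 2 / κ ^ 2) * T * (G₁ + G₂) := by gcongr; linarith

/-- The pointwise domination of the mixed-convolution summand:
`Γ_{(1−ε)c}(a, y) Γ_c(b, w−y) ≤ B₀ Γ_{(1−ε)c}(a+b, w) [Γ_{(1−ε)cε/4}(a, y) + Γ_{εc/4}(b, w−y)]`. -/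
theorem conv_pointwise {c ε : ℝ} (hc : 0 < c) (hε : 0 < ε) (hε1 : ε < 1) {a b : ℝ} (ha : 0 ≤ a)
    (hb : 0 ≤ b) (w y : Site 4) :
    gaussProfile ((1 - ε) * c) a y * gaussProfile c b (w - y) ≤
      (4 * Real.exp ((1 - ε) * c) * (1 + 2 / (ε * ((1 - ε) * c) / 48) ^ 2)) *
        gaussProfile ((1 - ε) * c) (a + b) w *
        (gaussProfile ((1 - ε) * c * ε / 4) a y + gaussProfile (ε * c / 4) b (w - y)) := by
  have hRxz : elen w ≤ elen y + elen (w - y) := by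
    have h := elen_add_le y (w - y)
    rwa [add_sub_cancel] at h
  have h := conv_real hc hε hε1 (p := 1 + a) (q := 1 + b) (by linarith) (by linarith)
    (elen_nonneg y) (elen_nonneg (w - y)) (elen_nonneg w) hRxz
  have e1 : (1 : ℝ) + a + (1 + b) - 1 = 1 + (a + b) := by ring
  rw [e1] at h
  unfold gaussProfile
  simpa only [mul_div_assoc] using h

/-- Conjunct (2), quantitative: summability and the bound
`Σ_y Γ_{(1−ε)c}(a, y) Γ_c(b, w−y) ≤ B Γ_{(1−ε)c}(a+b, w)` with an explicit `B = B(c, ε)`. -/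
theorem conv_bound {c ε : ℝ} (hc : 0 < c) (hε : 0 < ε) (hε1 : ε < 1) {a b : ℝ} (ha : 0 ≤ a)
    (hb : 0 ≤ b) (w : Site 4) :
    Summable (fun y : Site 4 => gaussProfile ((1 - ε) * c) a y * gaussProfile c b (w - y)) ∧
      ∑' y : Site 4, gaussProfile ((1 - ε) * c) a y * gaussProfile c b (w - y) ≤
        ((4 * Real.exp ((1 - ε) * c) * (1 + 2 / (ε * ((1 - ε) * c) / 48) ^ 2)) *
          (Real.exp (((1 - ε) * c * ε / 4) / 2) * (2 + 16 / ((1 - ε) * c * ε / 4)) ^ 4 +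
            Real.exp ((ε * c / 4) / 2) * (2 + 16 / (ε * c / 4)) ^ 4)) *
          gaussProfile ((1 - ε) * c) (a + b) w := by
  have hε' : 0 < 1 - ε := by linarith
  have hκ₁ : 0 < (1 - ε) * c * ε / 4 := by positivity
  have hκ₂ : 0 < ε * c / 4 := by positivity
  obtain ⟨hs1, hM1⟩ := mass_bound hκ₁ ha
  obtain ⟨hs2, hM2⟩ := mass_bound hκ₂ hb
  have hs2' : Summable (fun y : Site 4 => gaussProfile (ε * c / 4) b (w - y)) :=
    (Equiv.subLeft w).summable_iff.2 hs2
  have hM2' : ∑' y : Site 4, gaussProfile (ε * c / 4) b (w - y) ≤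
      Real.exp ((ε * c / 4) / 2) * (2 + 16 / (ε * c / 4)) ^ 4 := by
    have e := (Equiv.subLeft w).tsum_eq (fun u => gaussProfile (ε * c / 4) b u)
    simp only [Equiv.subLeft_apply] at e
    rw [e]
    exact hM2
  set B₀ := 4 * Real.exp ((1 - ε) * c) * (1 + 2 / (ε * ((1 - ε) * c) / 48) ^ 2) with hB₀
  set T := gaussProfile ((1 - ε) * c) (a + b) w with hT
  have hB₀0 : 0 ≤ B₀ := by positivity
  have hT0 : 0 ≤ T := gaussProfile_nonneg _ _ _
  set g := fun y : Site 4 => B₀ * T *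
    (gaussProfile ((1 - ε) * c * ε / 4) a y + gaussProfile (ε * c / 4) b (w - y)) with hg
  have hgs : Summable g := (hs1.add hs2').mul_left (B₀ * T)
  have hle : ∀ y : Site 4, gaussProfile ((1 - ε) * c) a y * gaussProfile c b (w - y) ≤ g y :=
    fun y => conv_pointwise hc hε hε1 ha hb w y
  have hnn : ∀ y : Site 4, 0 ≤ gaussProfile ((1 - ε) * c) a y * gaussProfile c b (w - y) :=
    fun y => mul_nonneg (gaussProfile_nonneg _ _ _) (gaussProfile_nonneg _ _ _)
  have hfs : Summable (fun y : Site 4 => gaussProfile ((1 - ε) * c) a y * gaussProfile c b (w - y)) :=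
    Summable.of_nonneg_of_le hnn hle hgs
  refine ⟨hfs, ?_⟩
  calc ∑' y : Site 4, gaussProfile ((1 - ε) * c) a y * gaussProfile c b (w - y)
      ≤ ∑' y : Site 4, g y := Summable.tsum_mono hfs hgs hle
    _ = B₀ * T * (∑' y : Site 4, gaussProfile ((1 - ε) * c * ε / 4) a y +
          ∑' y : Site 4, gaussProfile (ε * c / 4) b (w - y)) := by
        rw [hg, tsum_mul_left, Summable.tsum_add hs1 hs2']
    _ ≤ B₀ * T * (Real.exp (((1 - ε) * c * ε / 4) / 2) * (2 + 16 / ((1 - ε) * c * ε / 4)) ^ 4 +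
          Real.exp ((ε * c / 4) / 2) * (2 + 16 / (ε * c / 4)) ^ 4) := by
        gcongr
    _ = _ := by ring

/-- Registered headline of this helper file (aux stub of `stub_freeMajorantToolkit`): conjunct (2),
the mixed convolution bound of the free majorant toolkit. -/
theorem stub_freeMajorantToolkitAuxC : ∀ c ε : ℝ, 0 < c → 0 < ε → ε < 1 → ∃ B : ℝ, ∀ a b : ℝ, 0 ≤ a → 0 ≤ b → ∀ w : Site 4, Summable (fun y : Site 4 => gaussProfile ((1 - ε) * c) a y * gaussProfile c b (w - y)) ∧ ∑' y : Site 4, gaussProfile ((1 - ε) * c) a y * gaussProfile c b (w - y) ≤ B * gaussProfile ((1 - ε) * c) (a + b) w :=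
  fun _c _ε hc hε hε1 => ⟨_, fun _a _b ha hb w => conv_bound hc hε hε1 ha hb w⟩

end Summit.QuantumFields.QCD.Cruxes.QuarkLoopCoefficient.Sketch.FreeMajorantToolkit
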